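import Literature.AlgebraicGeometry.Resolution.WeakJacobianCondition
import Literature.AlgebraicGeometry.Resolution.WeakJacobianDerivations
import Mathlib.RingTheory.Kaehler.Basic
import Mathlib.RingTheory.LocalRing.ResidueField.Ideal
import Mathlib.RingTheory.RegularLocalRing.Polynomial
import Mathlib.RingTheory.Ideal.Height
import HarnessLib

/-!
# (WJ) holds in polynomial rings over a field (Matsumura §30, Thms. 30.3 and 30.5)

Topic: `Literature/AlgebraicGeometry/Resolution`. DISCHARGE of the named fact
`Matsumura1987_30_WJ_polynomial` of `WeakJacobianCondition.lean`: for every field `k`, every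
`n` and every prime `P` of `S = k[X_1, …, X_n]` of height `r`, there are derivations
`D_1, …, D_r ∈ Der(S)` and `f_1, …, f_r ∈ P` with `det(D_i f_j) ∉ P` (Matsumura, *Commutative
Ring Theory*, §32 p. 260: "by Theorems 30.3 and 30.5, (WJ) holds in `k[X_1, …, X_{n+m}]`";
Thm. 30.3 is the separable case, Thm. 30.5 Zariski's criterion over imperfect fields, both
applied with `I = P`, where the local ring `S_P/PS_P = κ(P)` is a field and so regular).

## The proof

We follow the mechanism of Matsumura's proof of Thm. 30.5, (1) ⇒ (2) (p. 235): `R = S_P` is a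
regular local ring of dimension `r = ht P` (Mathlib: polynomial rings over a field are regular,
`IsRegularLocalRing.iff_finrank_cotangentSpace`, `IsLocalization.AtPrime.ringKrullDim_eq_height`),
so `𝔪/𝔪²` (`𝔪 = PS_P`) is an `r`-dimensional `κ(P)`-vector space spanned by the images of the
elements of `P`; pick `f_1, …, f_r ∈ P` giving a basis. The printed proof embeds `𝔪/𝔪²` into
`Ω_R ⊗ κ(P)` (Thm. 25.2 with Thm. 26.9) and reads off derivations dual to `df_1, …, df_r` from a
`p`-basis of `k`; we use instead `exists_derivation_apply_eq` (`WeakJacobianDerivations.lean`,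
from Cohen's coefficient field of `R/𝔪²`): the coordinate functionals of the basis are induced
by derivations `E_i : S → κ(P)`, `E_i(f_j) = δ_ij`. A derivation `S = k[X] → κ(P)` is given by
a derivation of `k` and its values on the `X_l`; clearing denominators on the finitely many
relevant values (at the coefficients of the `f_j`, and at the `X_l`; `κ(P) = Frac(S/P)`) with a
common denominator `c ∉ P`, and choosing a `k`-basis of `Ω_{k/ℤ}` adapted to the differentials
of those coefficients, we build `D_i ∈ Der(S)` (`MvPolynomial.exists_derivation_C_eq_X_eq`)
with `D_i(f_j) ≡ c · E_i(f_j) mod P` (`MvPolynomial.derivation_apply_eq_of_eqOn`), so that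
`det(D_i f_j) ≡ c^r ≢ 0 mod P`.

Main results: `isWeakJacobianAt_mvPolynomial`, `isWeakJacobian_mvPolynomial`,
`Matsumura1987_30_WJ_polynomial_holds : Matsumura1987_30_WJ_polynomial`, and the corollaries
`Matsumura1987_32_polynomial_of_32_6'`, `Matsumura1987_32_6_cor_of_32_6'`: the named facts
`Matsumura1987_32_polynomial` and `Matsumura1987_32_6_cor` (`ExcellentRings.lean`) now rest on
Mizutani's theorem `Matsumura1987_32_6` alone.

## Sources

* H. Matsumura, *Commutative Ring Theory*, CUP 1986: §30 Thm. 30.3 p. 231 [PDF 249], Thm. 30.4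
  p. 233 [251], Thm. 30.5 (Zariski) pp. 234–235 [252–253], Lemma 2 and (WJ) p. 238 [256]; §32
  p. 260 [278] (proof of the Corollary to Thm. 32.6). [Matsumura1987]
-/

noncomputable section

open IsLocalRing MvPolynomial

namespace Literature.AlgebraicGeometry.Resolution

universe u

/-! ## 3. (WJ) holds in `k[X_1, …, X_n]` -/

section Assembly

variable (k : Type u) [Field k] (n : ℕ)

/-- **(WJ) holds at every prime of a polynomial ring over a field** (Matsumura Thms. 30.3, 30.5
with `I = P`; see the module docstring for the proof). For a prime `P` of `S = k[X_1, …, X_n]`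
of height `r` there are `D_1, …, D_r ∈ Der(S)` and `f_1, …, f_r ∈ P` with `det(D_i f_j) ∉ P`.
[cite: Matsumura1987, §32 p. 260, proof of Cor. of Thm. 32.6 (via Thms. 30.3, 30.5)] -/
theorem isWeakJacobianAt_mvPolynomial (P : Ideal (MvPolynomial (Fin n) k)) [hP : P.IsPrime] :
    IsWeakJacobianAt P := by
  classical
  -- Step 0: notation. `S = k[X]`, `Rp = S_P` (regular local), `K = κ(P)`, `M = P S_P`, `V = M/M²`.
  haveI : IsScalarTower (MvPolynomial (Fin n) k) (Localization.AtPrime P) P.ResidueField :=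
    IsScalarTower.of_algebraMap_eq' rfl
  haveI hreg : IsRegularLocalRing (Localization.AtPrime P) := inferInstance
  set r := Module.finrank P.ResidueField (CotangentSpace (Localization.AtPrime P)) with hr
  -- Step 1: `ht P = dim S_P = dim_K M/M² = r`.
  have hheight : P.height = r := by
    have h1 := (IsRegularLocalRing.iff_finrank_cotangentSpace (Localization.AtPrime P)).mp hreg
    rw [IsLocalization.AtPrime.ringKrullDim_eq_height P (Localization.AtPrime P)] at h1
    exact_mod_cast h1.symm
  -- Step 2: `M/M²` is spanned over `K` by the images of the elements of `P`.
  have hmemM : ∀ f : P, algebraMap (MvPolynomial (Fin n) k) (Localization.AtPrime P) f ∈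
      maximalIdeal (Localization.AtPrime P) := fun f =>
    (IsLocalization.AtPrime.to_map_mem_maximal_iff (Localization.AtPrime P) P (f : _)).mpr f.2
  set ι : P → CotangentSpace (Localization.AtPrime P) := fun f =>
    (maximalIdeal (Localization.AtPrime P)).toCotangent ⟨_, hmemM f⟩ with hι
  have hspan : Submodule.span P.ResidueField (Set.range ι) = ⊤ := by
    have hs : Set.range ι = (maximalIdeal (Localization.AtPrime P)).toCotangent ''
        Set.range (fun f : P => (⟨_, hmemM f⟩ : maximalIdeal (Localization.AtPrime P))) := by
      rw [← Set.range_comp]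
      rfl
    rw [hs, CotangentSpace.span_image_eq_top_iff]
    apply Submodule.map_injective_of_injective
      (maximalIdeal (Localization.AtPrime P)).injective_subtype
    rw [Submodule.map_span, Submodule.map_top, Submodule.range_subtype, ← Set.range_comp]
    have hrange : Set.range ((maximalIdeal (Localization.AtPrime P)).subtype ∘ fun f : P =>
        (⟨_, hmemM f⟩ : maximalIdeal (Localization.AtPrime P))) =
        algebraMap (MvPolynomial (Fin n) k) (Localization.AtPrime P) '' (P : Set _) := by
      rw [Set.image_eq_range]
      rfl
    rw [hrange]
    change Ideal.map (algebraMap (MvPolynomial (Fin n) k) (Localization.AtPrime P)) P = _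
    exact Localization.AtPrime.map_eq_maximalIdeal
  -- Step 3: a basis of `M/M²` made of images of `f_1, …, f_r ∈ P`, and its coordinates.
  obtain ⟨t, htsub, htspan, hli⟩ := exists_linearIndependent P.ResidueField (Set.range ι)
  rw [hspan] at htspan
  let b : Module.Basis t P.ResidueField (CotangentSpace (Localization.AtPrime P)) :=
    Module.Basis.mk hli (by rw [Subtype.range_coe, htspan])
  letI : Fintype t := FiniteDimensional.fintypeBasisIndex b
  have hcard : Fintype.card t = r := (Module.finrank_eq_card_basis b).symm
  let e : Fin r ≃ t := (Fintype.equivFinOfCardEq hcard).symm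
  have hsel : ∀ i : Fin r, ∃ f : P, ι f = ((e i : t) : CotangentSpace (Localization.AtPrime P)) :=
    fun i => htsub (e i).2
  choose f hf using hsel
  let b' : Module.Basis (Fin r) P.ResidueField (CotangentSpace (Localization.AtPrime P)) :=
    b.reindex e.symm
  have hb' : ∀ j, b' j = ι (f j) := fun j => by
    rw [Module.Basis.reindex_apply, Equiv.symm_symm, Module.Basis.mk_apply, hf]
  have hcoord : ∀ i j, b'.coord i (ι (f j)) = if j = i then 1 else 0 := fun i j => by
    rw [← hb', Module.Basis.coord_apply, Module.Basis.repr_self, Finsupp.single_apply]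
  -- Step 4: derivations `E_i : S_P → K` with `E_i(f_j) = δ_ij` (Cohen), pulled back to `S`.
  choose E hEadd hEmul hE using fun i : Fin r => exists_derivation_apply_eq k (b'.coord i)
  have hEf : ∀ i j, E i (algebraMap _ (Localization.AtPrime P) (f j : MvPolynomial (Fin n) k)) =
      if j = i then 1 else 0 := fun i j => by
    rw [hE i ⟨_, hmemM (f j)⟩, ← hcoord i j]
  have hE0 : ∀ i, E i 0 = 0 := fun i => by
    have h := hEadd i 0 0
    rw [add_zero] at h
    exact left_eq_add.mp h
  -- the pull-backs `E'_i : S → K`, as derivations of `S`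
  let E' : Fin r → Derivation ℤ (MvPolynomial (Fin n) k) P.ResidueField := fun i =>
    Derivation.mk'
      (AddMonoidHom.toIntLinearMap
        { toFun := fun s => E i (algebraMap _ (Localization.AtPrime P) s)
          map_zero' := by rw [map_zero, hE0]
          map_add' := fun a b => by rw [map_add, hEadd] })
      fun a b => by
        change E i (algebraMap _ (Localization.AtPrime P) (a * b)) =
          a • E i (algebraMap _ (Localization.AtPrime P) b) +
            b • E i (algebraMap _ (Localization.AtPrime P) a)
        rw [map_mul, hEmul, algebraMap_smul, algebraMap_smul]
  have hE'apply : ∀ i (s : MvPolynomial (Fin n) k),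
      E' i s = E i (algebraMap _ (Localization.AtPrime P) s) := fun i s => rfl
  -- Step 5: a common denominator `c ∉ P` for the finitely many relevant values of the `E'_i`.
  set Cf : Finset k := (Finset.univ : Finset (Fin r)).biUnion fun j =>
    (f j : MvPolynomial (Fin n) k).coeffs with hCf
  set vals : Finset P.ResidueField := (Finset.univ : Finset (Fin r)).biUnion fun i =>
    Cf.image (fun c => E' i (C c)) ∪ (Finset.univ : Finset (Fin n)).image fun l => E' i (X l)
    with hvals
  have hCvals : ∀ i, ∀ c ∈ Cf, E' i (C c) ∈ vals := fun i c hc => by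
    rw [hvals, Finset.mem_biUnion]
    exact ⟨i, Finset.mem_univ _, Finset.mem_union_left _ (Finset.mem_image_of_mem _ hc)⟩
  have hXvals : ∀ i l, E' i (X l) ∈ vals := fun i l => by
    rw [hvals, Finset.mem_biUnion]
    exact ⟨i, Finset.mem_univ _, Finset.mem_union_right _
      (Finset.mem_image_of_mem _ (Finset.mem_univ l))⟩
  have hcoeffCf : ∀ j, ∀ c ∈ (f j : MvPolynomial (Fin n) k).coeffs, c ∈ Cf := fun j c hc => by
    rw [hCf, Finset.mem_biUnion]
    exact ⟨j, Finset.mem_univ _, hc⟩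
  obtain ⟨d, hd⟩ := IsLocalization.exist_integer_multiples_of_finset
    (nonZeroDivisors (MvPolynomial (Fin n) k ⧸ P)) vals
  obtain ⟨c, hc⟩ := Ideal.Quotient.mk_surjective (d : MvPolynomial (Fin n) k ⧸ P)
  have hcP : c ∉ P := fun h => by
    have : (d : MvPolynomial (Fin n) k ⧸ P) = 0 := by
      rw [← hc]; exact Ideal.Quotient.eq_zero_iff_mem.mpr h
    exact nonZeroDivisors.coe_ne_zero d this
  set cK : P.ResidueField := algebraMap (MvPolynomial (Fin n) k) P.ResidueField c with hcK
  have hcK0 : cK ≠ 0 := fun h => hcP (Ideal.algebraMap_residueField_eq_zero.mp h)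
  have hint : ∀ a ∈ vals, ∃ s : MvPolynomial (Fin n) k,
      algebraMap (MvPolynomial (Fin n) k) P.ResidueField s = cK * a := fun a ha => by
    obtain ⟨x, hx⟩ := hd a ha
    obtain ⟨s, rfl⟩ := Ideal.Quotient.mk_surjective x
    refine ⟨s, ?_⟩
    rw [Ideal.algebraMap_quotient_residueField_mk] at hx
    rw [hx, Algebra.smul_def, ← hc, Ideal.algebraMap_quotient_residueField_mk]
  -- integral lifts: `lift a ∈ S` maps to `c · a` whenever `c · a` is integral
  let lift : P.ResidueField → MvPolynomial (Fin n) k := fun a =>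
    if h : ∃ s : MvPolynomial (Fin n) k, algebraMap _ P.ResidueField s = cK * a then h.choose
    else 0
  have hlift : ∀ a ∈ vals, algebraMap _ P.ResidueField (lift a) = cK * a := fun a ha => by
    simp only [lift, dif_pos (hint a ha)]
    exact (hint a ha).choose_spec
  -- Step 6: derivations `δ_i` of `k` into `S` approximating `E'_i ∘ C` on `Cf` modulo `P`,
  -- via a `k`-basis of `Ω_{k/ℤ}` adapted to the differentials of the elements of `Cf`.
  set dset : Set (Ω[k⁄ℤ]) := (fun c => KaehlerDifferential.D ℤ k c) '' (Cf : Set k) with hdset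
  obtain ⟨t₂, ht₂sub, ht₂span, hli₂⟩ := exists_linearIndependent k dset
  have hli₂' : LinearIndepOn k id t₂ := hli₂
  set B := Module.Basis.extend hli₂' with hB
  -- `λ_i : Ω_{k/ℤ} → K`, the linear form of the derivation `E'_i ∘ C`
  let dk : Fin r → Derivation ℤ k P.ResidueField := fun i =>
    Derivation.mk'
      (AddMonoidHom.toIntLinearMap
        { toFun := fun a => E' i (C a)
          map_zero' := by rw [C_0, map_zero]
          map_add' := fun a b => by rw [C_add, map_add] })
      fun a b => by
        change E' i (C (a * b)) = a • E' i (C b) + b • E' i (C a)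
        rw [C_mul, Derivation.leibniz, ← MvPolynomial.algebraMap_eq, algebraMap_smul,
          algebraMap_smul]
  have hdk : ∀ i a, dk i a = E' i (C a) := fun i a => rfl
  let lam : Fin r → (Ω[k⁄ℤ] →ₗ[k] P.ResidueField) := fun i => (dk i).liftKaehlerDifferential
  have hlam : ∀ i a, lam i (KaehlerDifferential.D ℤ k a) = E' i (C a) := fun i a => by
    rw [Derivation.liftKaehlerDifferential_comp_D, hdk]
  let μ : Fin r → (Ω[k⁄ℤ] →ₗ[k] MvPolynomial (Fin n) k) := fun i =>
    B.constr k fun w => lift (lam i (w : Ω[k⁄ℤ]))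
  -- the key congruence on `span t₂ ∋ dc` for `c ∈ Cf`
  have hμ : ∀ i, ∀ c ∈ Cf, algebraMap _ P.ResidueField (μ i (KaehlerDifferential.D ℤ k c)) =
      cK * E' i (C c) := by
    intro i c hc
    have hmem : KaehlerDifferential.D ℤ k c ∈ Submodule.span k t₂ := by
      rw [ht₂span]
      exact Submodule.subset_span ⟨c, hc, rfl⟩
    have heq : Set.EqOn
        (((Algebra.linearMap (MvPolynomial (Fin n) k) P.ResidueField).restrictScalars k) ∘ₗ μ i)
        (cK • lam i : Ω[k⁄ℤ] →ₗ[k] P.ResidueField) t₂ := by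
      intro w hw
      obtain ⟨c', hc', rfl⟩ := ht₂sub hw
      have hBw : B ⟨KaehlerDifferential.D ℤ k c', Module.Basis.subset_extend hli₂' hw⟩ =
          KaehlerDifferential.D ℤ k c' := Module.Basis.extend_apply_self hli₂' _
      change algebraMap _ P.ResidueField (μ i (KaehlerDifferential.D ℤ k c')) =
        cK * lam i (KaehlerDifferential.D ℤ k c')
      rw [← hBw]
      change algebraMap _ P.ResidueField (B.constr k (fun w => lift (lam i (w : Ω[k⁄ℤ])))
        (B ⟨KaehlerDifferential.D ℤ k c', _⟩)) = _
      rw [Module.Basis.constr_basis, hBw, hlam]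
      exact hlift _ (hCvals i c' hc')
    have := LinearMap.eqOn_span heq hmem
    rw [← hlam]
    exact this
  let δ : Fin r → Derivation ℤ k (MvPolynomial (Fin n) k) := fun i =>
    (μ i).compDer (KaehlerDifferential.D ℤ k)
  have hδ : ∀ i a, δ i a = μ i (KaehlerDifferential.D ℤ k a) := fun i a => rfl
  -- Step 7: the derivations `D_i ∈ Der(S)` and the congruence `D_i(f_j) ≡ c E'_i(f_j) mod P`.
  choose D hDC hDX using fun i =>
    MvPolynomial.exists_derivation_C_eq_X_eq (T := MvPolynomial (Fin n) k) (δ i)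
      fun l => lift (E' i (X l))
  have hcong : ∀ i j, algebraMap _ P.ResidueField (D i (f j : MvPolynomial (Fin n) k)) =
      cK * E' i (f j : MvPolynomial (Fin n) k) := by
    intro i j
    -- both sides are derivations `S → K` agreeing on the coefficients of `f_j` and on the `X_l`
    let Δ₁ : Derivation ℤ (MvPolynomial (Fin n) k) P.ResidueField :=
      (Algebra.linearMap (MvPolynomial (Fin n) k) P.ResidueField).compDer (D i)
    have h := MvPolynomial.derivation_apply_eq_of_eqOn Δ₁ (cK • E' i)
      (f j : MvPolynomial (Fin n) k) (fun a ha => ?_) (fun l => ?_)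
    · exact h
    · change algebraMap _ P.ResidueField (D i (C a)) = cK • E' i (C a)
      rw [hDC, hδ, smul_eq_mul]
      exact hμ i a (hcoeffCf j a ha)
    · change algebraMap _ P.ResidueField (D i (X l)) = cK • E' i (X l)
      rw [hDX, smul_eq_mul]
      exact hlift _ (hXvals i l)
  -- Step 8: `det(D_i f_j) ≡ c^r ≢ 0 mod P`.
  have hdet : (Matrix.of fun i j => D i (f j : MvPolynomial (Fin n) k)).det ∉ P := by
    intro hmem
    have h0 := Ideal.algebraMap_residueField_eq_zero.mpr hmem
    rw [RingHom.map_det, RingHom.mapMatrix_apply] at h0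
    have hM : (Matrix.of fun i j => D i (f j : MvPolynomial (Fin n) k)).map
        (algebraMap (MvPolynomial (Fin n) k) P.ResidueField) = Matrix.diagonal fun _ => cK := by
      ext i j
      rw [Matrix.map_apply, Matrix.of_apply, hcong, hE'apply, hEf, Matrix.diagonal_apply]
      by_cases hij : i = j
      · subst hij; simp
      · rw [if_neg (Ne.symm hij), if_neg hij, mul_zero]
    rw [hM, Matrix.det_diagonal, Finset.prod_const, Finset.card_univ, Fintype.card_fin] at h0
    exact pow_ne_zero r hcK0 h0
  -- Step 9: assemble.
  exact ⟨r, hheight, D, fun j => (f j : MvPolynomial (Fin n) k), fun j => (f j).2, hdet⟩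

/-- **(WJ) holds in `k[X_1, …, X_n]`** for every field `k` (Matsumura §32, p. 260: "by
Theorems 30.3 and 30.5, (WJ) holds in `k[X_1, …, X_{n+m}]`").
[cite: Matsumura1987, §32 p. 260, proof of Cor. of Thm. 32.6 (via Thms. 30.3, 30.5)] -/
theorem isWeakJacobian_mvPolynomial : IsWeakJacobian (MvPolynomial (Fin n) k) :=
  fun P _ => isWeakJacobianAt_mvPolynomial k n P

/-- DISCHARGE of the named fact `Matsumura1987_30_WJ_polynomial` (`WeakJacobianCondition.lean`):
the weak Jacobian condition holds in every polynomial ring `k[X_1, …, X_n]` over a field.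
[cite: Matsumura1987, §32 p. 260, proof of Cor. of Thm. 32.6 (via Thms. 30.3, 30.5)] -/
theorem Matsumura1987_30_WJ_polynomial_holds : Matsumura1987_30_WJ_polynomial.{u} :=
  fun k _ n => isWeakJacobian_mvPolynomial k n

/-- `Matsumura1987_32_polynomial` (`k[X_1, …, X_n]` is a G-ring) now follows from Mizutani's
theorem `Matsumura1987_32_6` alone. [cite: Matsumura1987, §32 p. 260, proof of Cor. of Thm. 32.6] -/
theorem Matsumura1987_32_polynomial_of_32_6' (h326 : Matsumura1987_32_6.{u}) :
    Matsumura1987_32_polynomial.{u} :=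
  Matsumura1987_32_polynomial_of_32_6 h326 Matsumura1987_30_WJ_polynomial_holds

/-- `Matsumura1987_32_6_cor` (finitely generated algebras over a field are G-rings) now follows
from Mizutani's theorem `Matsumura1987_32_6` alone: the quotient step is
the hypothesis `hq` (discharged as `Matsumura1987_32_quotient_holds` in `ExcellentRingsProofs.lean`,
which this file does not import).
[cite: Matsumura1987, Cor. of Thm. 32.6, p. 260] -/
theorem Matsumura1987_32_6_cor_of_32_6' (hq : Matsumura1987_32_quotient.{u})
    (h326 : Matsumura1987_32_6.{u}) : Matsumura1987_32_6_cor.{u} :=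
  Matsumura1987_32_6_cor_of_32_6 hq h326 Matsumura1987_30_WJ_polynomial_holds

end Assembly

end Literature.AlgebraicGeometry.Resolution

end
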